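import Summits.Schanuel.Schanuel.Theorems.RootDecomp1BTwoStorey04

/-!
# RootDecomp1BTwoStorey — lens 4, generation 43 «TWO-PARAMETER RADICAL DESCENT: STOREY THREE AT (1, ρ, σ)» (lane B-R26 (e); CLAIM L2197, ACK/CHECKLIST B-g43 L2199, NODE L2206 / REQUEST L2207, writer re-check L2211, critic VERDICT L2210: CLEARED — ONE CELL (lane (e) «m = 3 storeys»; engine VARIANT-REACH+ of g30, class NEW-LOCAL, territory NEW); RULE B-R29; lens-4 tally THEOREM ×7 + CELL ×4) — continuation (RootDecomp1BTwoStorey05): §D part 1 — the clash engine `radical₂_clash` (census cap edition)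

(lens-4 g43 HOME kernel K = HOME/decomp-schanuel-lens-4/g43/TwoStorey.lean 24f29895…, 1683 l; VERDICT L2210 PORT GO; port by census-1 gen 19 as `RootDecomp1BTwoStorey01`–`06`: 01 = §A formal algebra + §B sizes; 02 = §D-data + §C part 1 (classes `UltraLiouville₂` / `JU`); 03 = §C part 2 (collision, two-dimensional non-vanishing, typed obstruction); 04 = §C part 3 (Baire density, controls); 05 = §D part 1: the CLASH ENGINE `radical₂_clash` (steps (2)–(5) of the g43 kernel proof stated on their own — census CAP EDITION, HAND-BACK L2252 / critic CONCUR L2253 under RESHAPE RULE L1684: the kernel `algebraicIndependent_radical₂` was ONE 459-line declaration > the 400-line file cap); 06 = §D part 2: THE KERNEL `algebraicIndependent_radical₂` (statement BYTE-IDENTICAL to K; proof = K's steps (0)–(1) verbatim + `exact radical₂_clash …`); 07 = §E storey-three cells.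
PORT EDITS: class defs' docstrings tagged; private port copies of length lemmas kept private; §D re-cut for the cap (one new public lemma `radical₂_clash`, proof text moved verbatim modulo the abstraction of the eigenvalue as `Φ` with `‖Φ‖ ≤ q^J·Kl·dJ`; nine now-unused local `have`s of the kernel dropped); every other statement and proof verbatim. `--supports stmt-Schanuel-24622`; no census credit carried; rung 0 — nothing here proves Schanuel.)
-/

noncomputable section

open Complex

namespace Summit.Schanuel.Schanuel.Theorems.RootDecomp1BTwoStorey

open Summit.Schanuel.Schanuel.Theorems.RootDecomp1BRadicalDescent (resFin resFin_val powSubst powSubst_X_self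
  powSubst_eq_zero_iff QDiv qdiv_powSubst residue_lemma)

/-! ## §D  THE KERNEL: two-parameter radical descent -/

section Kernel
open MvPolynomial
open Summit.Schanuel.Schanuel.Theorems.RootDecomp1BRadicalDescent (UltraLiouville DExpMeasure exists_int_relation
  kernel_clash_ineq norm_mvaeval_le_mvlen totalDegree_det_le mvlen_det_le adjugate_bounds)
open Summit.Schanuel.Schanuel.Theorems.RootDecomp1KHyper (mvlen mvlen_nonneg abs_coeff_le_mvlen one_le_mvlen)
variable {n : ℕ}

/-- `x^k ≤ exp (k x)` for `x ≥ 0`. -/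
private theorem pow_le_exp_mul {x : ℝ} (hx : 0 ≤ x) (k : ℕ) : x ^ k ≤ Real.exp (k * x) := by
  rw [Real.exp_nat_mul]
  exact pow_le_pow_left₀ hx (by linarith [Real.add_one_le_exp x]) k

/-- `q ≤ exp q` for a natural number `q`. -/
private theorem natCast_le_exp (q : ℕ) : (q : ℝ) ≤ Real.exp q := by linarith [Real.add_one_le_exp (q : ℝ)]

/-- **THE CLASH ENGINE of the two-parameter radical descent** (steps (2)–(5) of the kernel below, stated on
their own for the tree's 400-line file cap — census port edition, proof text verbatim from lens-4 g43's
`algebraicIndependent_radical₂`): given the degree-uniform measure of `θ` (exponent `A₀`), a nonzero norm form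
`N = det M` with the entry/length/degree bounds of §B, its evaluation `Mθ` at `θ` with the EIGEN-FACTORISATION
`det Mθ = Φ · Σ_a adj(Mθ)_{0a} s^a` where the eigenvalue is small, `‖Φ‖ ≤ q^J · Kl · dJ` with
`dJ ≤ exp(−exp(q^{A+1}))`, and `q ≥ Q₁ > c₃ + 2 + α` past the displayed thresholds, the measure (lower bound) and
the factorisation (upper bound) CLASH (`kernel_clash_ineq` of `RootDecomp1BRadicalDescent03`, verbatim). -/
theorem radical₂_clash {q : ℕ} (hq : 0 < q) {θ : Fin n → ℂ} {A₀ : ℕ}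
    (hA₀ : ∀ P : MvPolynomial (Fin n) ℤ, P ≠ 0 →
      Real.exp (-((Real.log (mvlen P : ℝ) + 1) * Real.exp ((A₀ : ℝ) * ((P.totalDegree : ℝ) + 1) ^ A₀))) ≤
        ‖MvPolynomial.aeval θ P‖)
    {N : MvPolynomial (Fin n) ℤ} (hN0 : N ≠ 0)
    {M : Matrix (Fin q) (Fin q) (MvPolynomial (Fin n) ℤ)} {Mθ : Matrix (Fin q) (Fin q) ℂ}
    (hdet : Mθ.det = aeval θ N)
    (hadj : ∀ a' : Fin q, Mθ.adjugate ⟨0, hq⟩ a' = aeval θ (M.adjugate ⟨0, hq⟩ a'))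
    {E : ℤ} (hE1 : 1 ≤ E) {δe : ℕ}
    (hNlen : mvlen N ≤ (q.factorial : ℤ) * E ^ q) (hNdeg : N.totalDegree ≤ q * δe)
    (hadjB : ∀ a' : Fin q, mvlen (M.adjugate ⟨0, hq⟩ a') ≤ (q.factorial : ℤ) * E ^ q ∧
      (M.adjugate ⟨0, hq⟩ a').totalDegree ≤ q * δe)
    {Θ : ℝ} (hΘ1 : 1 ≤ Θ) (hθΘ : ∀ i, ‖θ i‖ ≤ Θ) {s : ℂ} (hsΘ : ‖s‖ ≤ Θ)
    {Φ : ℂ} (hfact : Mθ.det = Φ * ∑ a' : Fin q, Mθ.adjugate ⟨0, hq⟩ a' * s ^ (a' : ℕ))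
    {Kl dJ : ℝ} (hKl : 0 ≤ Kl) (hd0 : 0 ≤ dJ) {J : ℕ} (hΦ : ‖Φ‖ ≤ (q : ℝ) ^ J * (Kl * dJ))
    {A : ℕ} (hA : A = A₀ + 1) (hdistle : dJ ≤ Real.exp (-Real.exp ((q : ℝ) ^ (A + 1))))
    {K₁ K₂ a b Bρ Bσ : ℕ} {LP : ℤ} (hLP1 : 1 ≤ LP) (haB : a ≤ Bρ * q) (hbB : b ≤ Bσ * q)
    (hEdef : E = (((K₁ : ℤ) + 1) * ((K₂ : ℤ) + 1)) * (LP * ((a : ℤ) + b + q) ^ J))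
    {cE cN cU c₃ α : ℝ}
    (hcE : cE = ((K₁ : ℝ) + 1) * ((K₂ : ℝ) + 1) + LP + J * ((Bρ : ℝ) + Bσ + 1))
    (hcN : cN = cE + 2) (hcU : cU = ((J : ℝ) + 2) + cE + Θ * ((δe : ℝ) + 1))
    (hc₃ : c₃ = (Kl + 1) + cU + cN) (hα : α = A * ((δe : ℝ) + 1) ^ A)
    {Q₁ : ℕ} (hQ₁ : c₃ + 2 + α < Q₁) (hqQ₁ : Q₁ ≤ q) : False := by
  have hA1 : 1 ≤ A := by omega
  have hq1r : (1 : ℝ) ≤ q := by exact_mod_cast hq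
  have hq0r : (0 : ℝ) < q := by positivity
  have hqsq : (q : ℝ) ≤ (q : ℝ) ^ 2 := by nlinarith only [hq1r]
  have hq2 : (1 : ℝ) ≤ (q : ℝ) ^ 2 := hq1r.trans hqsq
  have hΘ0 : 0 ≤ Θ := by linarith
  have hLP1r : (1 : ℝ) ≤ LP := by exact_mod_cast hLP1
  have hcE0 : 0 ≤ cE := by rw [hcE]; positivity
  have hcN0 : 0 ≤ cN := by rw [hcN]; positivity
  have hcU0 : 0 ≤ cU := by rw [hcU]; positivity
  have hα0 : 0 ≤ α := by rw [hα]; positivity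
  have hc₃0 : 0 ≤ c₃ := by rw [hc₃]; positivity
  have hEr : (E : ℝ) ≤ Real.exp (((K₁ : ℝ) + 1) * ((K₂ : ℝ) + 1) + LP + J * (((Bρ : ℝ) + Bσ + 1) * q)) := by
    have h1 : ((K₁ : ℝ) + 1) * ((K₂ : ℝ) + 1) ≤ Real.exp (((K₁ : ℝ) + 1) * ((K₂ : ℝ) + 1)) := by
      linarith [Real.add_one_le_exp (((K₁ : ℝ) + 1) * ((K₂ : ℝ) + 1))]
    have h2 : (LP : ℝ) ≤ Real.exp (LP : ℝ) := by linarith [Real.add_one_le_exp (LP : ℝ)]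
    have h3 : ((a : ℝ) + b + q) ^ J ≤ Real.exp (J * (((Bρ : ℝ) + Bσ + 1) * q)) := by
      have hpq' : (a : ℝ) + b + q ≤ ((Bρ : ℝ) + Bσ + 1) * q := by
        have t1 : (a : ℝ) ≤ Bρ * q := by exact_mod_cast haB
        have t2 : (b : ℝ) ≤ Bσ * q := by exact_mod_cast hbB
        linarith
      exact (pow_le_pow_left₀ (by positivity) hpq' J).trans (pow_le_exp_mul (by positivity) J)
    have key : (((K₁ : ℝ) + 1) * ((K₂ : ℝ) + 1)) * ((LP : ℝ) * ((a : ℝ) + b + q) ^ J) ≤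
        Real.exp (((K₁ : ℝ) + 1) * ((K₂ : ℝ) + 1)) *
          (Real.exp (LP : ℝ) * Real.exp (J * (((Bρ : ℝ) + Bσ + 1) * q))) :=
      mul_le_mul h1 (mul_le_mul h2 h3 (by positivity) (Real.exp_pos _).le) (by positivity)
        (Real.exp_pos _).le
    have hEcast : (E : ℝ) = (((K₁ : ℝ) + 1) * ((K₂ : ℝ) + 1)) * ((LP : ℝ) * ((a : ℝ) + b + q) ^ J) := by
      rw [hEdef]; push_cast; ring
    rw [hEcast]
    calc _ ≤ _ := key
      _ = Real.exp (((K₁ : ℝ) + 1) * ((K₂ : ℝ) + 1) + LP + J * (((Bρ : ℝ) + Bσ + 1) * q)) := by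
          rw [← Real.exp_add, ← Real.exp_add]; congr 1; ring
  have hE0r : (0 : ℝ) ≤ E := by exact_mod_cast (zero_le_one.trans hE1)
  have hEq : (E : ℝ) ^ q ≤ Real.exp (cE * (q : ℝ) ^ 2) := by
    refine (pow_le_pow_left₀ hE0r hEr q).trans ?_
    rw [← Real.exp_nat_mul, Real.exp_le_exp, hcE]
    have t1 : ((K₁ : ℝ) + 1) * ((K₂ : ℝ) + 1) * q ≤ ((K₁ : ℝ) + 1) * ((K₂ : ℝ) + 1) * (q : ℝ) ^ 2 :=
      mul_le_mul_of_nonneg_left hqsq (by positivity)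
    have t2 : (LP : ℝ) * q ≤ (LP : ℝ) * (q : ℝ) ^ 2 := mul_le_mul_of_nonneg_left hqsq (by linarith)
    have t3 : (q : ℝ) * (J * (((Bρ : ℝ) + Bσ + 1) * q)) = J * ((Bρ : ℝ) + Bσ + 1) * (q : ℝ) ^ 2 := by ring
    linarith only [t1, t2, t3]
  have hfac : ((q.factorial : ℕ) : ℝ) ≤ Real.exp ((q : ℝ) ^ 2) := by
    have h1 : ((q.factorial : ℕ) : ℝ) ≤ (q : ℝ) ^ q := by exact_mod_cast Nat.factorial_le_pow q
    refine h1.trans ((pow_le_exp_mul hq0r.le q).trans (le_of_eq ?_))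
    rw [sq]
  have hqpow : ∀ k : ℕ, (q : ℝ) ^ k ≤ Real.exp (k * (q : ℝ) ^ 2) := fun k =>
    (pow_le_exp_mul hq0r.le k).trans (by
      rw [Real.exp_le_exp]; exact mul_le_mul_of_nonneg_left hqsq (Nat.cast_nonneg k))
  have hΘpow : ∀ k : ℕ, Θ ^ k ≤ Real.exp (k * Θ) := fun k => pow_le_exp_mul hΘ0 k
  -- (3) lower bound from the measure
  have hlow : Real.exp (-(cN * (q : ℝ) ^ 2 * Real.exp (α * (q : ℝ) ^ A))) ≤ ‖aeval θ N‖ := by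
    refine le_trans ?_ (hA₀ N hN0)
    rw [Real.exp_le_exp, neg_le_neg_iff]
    have hlen : Real.log (mvlen N : ℝ) + 1 ≤ cN * (q : ℝ) ^ 2 := by
      have h1 : (mvlen N : ℝ) ≤ Real.exp ((q : ℝ) ^ 2) * Real.exp (cE * (q : ℝ) ^ 2) := by
        have : (mvlen N : ℝ) ≤ ((q.factorial : ℕ) : ℝ) * (E : ℝ) ^ q := by exact_mod_cast hNlen
        exact this.trans (mul_le_mul hfac hEq (by positivity) (Real.exp_pos _).le)
      have h2 : (0 : ℝ) < mvlen N := by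
        have := one_le_mvlen hN0
        exact_mod_cast (show (0 : ℤ) < mvlen N by omega)
      have h3 : Real.log (mvlen N : ℝ) ≤ (q : ℝ) ^ 2 + cE * (q : ℝ) ^ 2 := by
        rw [← Real.exp_add] at h1
        exact (Real.log_le_log h2 h1).trans_eq (Real.log_exp _)
      rw [hcN]; linarith only [h3, hq2]
    have hdeg : (A₀ : ℝ) * ((N.totalDegree : ℝ) + 1) ^ A₀ ≤ α * (q : ℝ) ^ A := by
      have h1 : (N.totalDegree : ℝ) + 1 ≤ ((δe : ℝ) + 1) * q := by
        have : (N.totalDegree : ℝ) ≤ q * δe := by exact_mod_cast hNdeg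
        linarith only [this, hq1r]
      have hδq1 : (1 : ℝ) ≤ ((δe : ℝ) + 1) * q :=
        one_le_mul_of_one_le_of_one_le (by linarith only [Nat.cast_nonneg (α := ℝ) δe]) hq1r
      have h2 : ((N.totalDegree : ℝ) + 1) ^ A₀ ≤ (((δe : ℝ) + 1) * q) ^ A := by
        refine (pow_le_pow_left₀ (by positivity) h1 A₀).trans ?_
        exact pow_le_pow_right₀ hδq1 (by omega)
      have h3 : (A₀ : ℝ) ≤ A := by rw [hA]; push_cast; linarith
      rw [hα]
      rw [mul_pow] at h2
      calc (A₀ : ℝ) * ((N.totalDegree : ℝ) + 1) ^ A₀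
          ≤ (A : ℝ) * ((((δe : ℝ) + 1)) ^ A * (q : ℝ) ^ A) :=
            mul_le_mul h3 h2 (by positivity) (by positivity)
        _ = (A : ℝ) * ((δe : ℝ) + 1) ^ A * (q : ℝ) ^ A := by ring
    have hlen0 : 0 ≤ Real.log (mvlen N : ℝ) + 1 := by
      have : (1 : ℝ) ≤ mvlen N := by exact_mod_cast (one_le_mvlen hN0)
      linarith [Real.log_nonneg this]
    calc (Real.log (mvlen N : ℝ) + 1) * Real.exp ((A₀ : ℝ) * ((N.totalDegree : ℝ) + 1) ^ A₀)
        ≤ (cN * (q : ℝ) ^ 2) * Real.exp (α * (q : ℝ) ^ A) :=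
          mul_le_mul hlen (Real.exp_le_exp.2 hdeg) (Real.exp_pos _).le (by positivity)
      _ = cN * (q : ℝ) ^ 2 * Real.exp (α * (q : ℝ) ^ A) := by ring
  -- (4) upper bound from the factorisation
  have hup : ‖aeval θ N‖ ≤ (Kl + 1) * Real.exp (cU * (q : ℝ) ^ 2) *
      Real.exp (-Real.exp ((q : ℝ) ^ (A + 1))) := by
    have hS : ‖∑ a' : Fin q, Mθ.adjugate ⟨0, hq⟩ a' * s ^ (a' : ℕ)‖ ≤
        (q : ℝ) * ((((q.factorial : ℕ) : ℝ) * (E : ℝ) ^ q) * Θ ^ (q * δe) * Θ ^ q) := by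
      refine (norm_sum_le _ _).trans ?_
      have hterm : ∀ a' : Fin q, ‖Mθ.adjugate ⟨0, hq⟩ a' * s ^ (a' : ℕ)‖ ≤
          (((q.factorial : ℕ) : ℝ) * (E : ℝ) ^ q) * Θ ^ (q * δe) * Θ ^ q := by
        intro a'
        rw [norm_mul, norm_pow, hadj]
        have h1 := norm_mvaeval_le_mvlen (M.adjugate ⟨0, hq⟩ a') θ hΘ1 hθΘ
        have h2 : (mvlen (M.adjugate ⟨0, hq⟩ a') : ℝ) ≤ ((q.factorial : ℕ) : ℝ) * (E : ℝ) ^ q := by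
          exact_mod_cast (hadjB a').1
        have h3 : Θ ^ (M.adjugate ⟨0, hq⟩ a').totalDegree ≤ Θ ^ (q * δe) :=
          pow_le_pow_right₀ hΘ1 (hadjB a').2
        have h4 : ‖s‖ ^ (a' : ℕ) ≤ Θ ^ q :=
          (pow_le_pow_left₀ (norm_nonneg _) hsΘ _).trans (pow_le_pow_right₀ hΘ1 a'.isLt.le)
        have h0 : (0 : ℝ) ≤ (mvlen (M.adjugate ⟨0, hq⟩ a') : ℝ) := by
          exact_mod_cast mvlen_nonneg _
        calc ‖aeval θ (M.adjugate ⟨0, hq⟩ a')‖ * ‖s‖ ^ (a' : ℕ)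
            ≤ ((mvlen (M.adjugate ⟨0, hq⟩ a') : ℝ) * Θ ^ (M.adjugate ⟨0, hq⟩ a').totalDegree) * Θ ^ q :=
              mul_le_mul h1 h4 (by positivity) (by positivity)
          _ ≤ (((q.factorial : ℕ) : ℝ) * (E : ℝ) ^ q) * Θ ^ (q * δe) * Θ ^ q := by
              refine mul_le_mul_of_nonneg_right ?_ (by positivity)
              exact mul_le_mul h2 h3 (by positivity) (by positivity)
      calc ∑ a' : Fin q, ‖Mθ.adjugate ⟨0, hq⟩ a' * s ^ (a' : ℕ)‖
          ≤ ∑ _a' : Fin q, (((q.factorial : ℕ) : ℝ) * (E : ℝ) ^ q) * Θ ^ (q * δe) * Θ ^ q :=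
            Finset.sum_le_sum fun a' _ => hterm a'
        _ = (q : ℝ) * ((((q.factorial : ℕ) : ℝ) * (E : ℝ) ^ q) * Θ ^ (q * δe) * Θ ^ q) := by simp
    have hjunk : (q : ℝ) ^ J * ((q : ℝ) * ((((q.factorial : ℕ) : ℝ) * (E : ℝ) ^ q) *
        Θ ^ (q * δe) * Θ ^ q)) ≤ Real.exp (cU * (q : ℝ) ^ 2) := by
      have h1 := hqpow J
      have h2 : (q : ℝ) ≤ Real.exp ((q : ℝ) ^ 2) :=
        (natCast_le_exp q).trans (Real.exp_le_exp.2 hqsq)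
      have h3 := hfac
      have h4 := hEq
      have h5 : Θ ^ (q * δe) * Θ ^ q ≤ Real.exp (Θ * (((δe : ℝ) + 1)) * (q : ℝ) ^ 2) := by
        rw [← pow_add]
        refine (hΘpow _).trans ?_
        rw [Real.exp_le_exp]
        push_cast
        calc ((q : ℝ) * δe + q) * Θ = ((δe : ℝ) + 1) * Θ * q := by ring
          _ ≤ ((δe : ℝ) + 1) * Θ * (q : ℝ) ^ 2 := mul_le_mul_of_nonneg_left hqsq (by positivity)
          _ = Θ * ((δe : ℝ) + 1) * (q : ℝ) ^ 2 := by ring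
      calc (q : ℝ) ^ J * ((q : ℝ) * ((((q.factorial : ℕ) : ℝ) * (E : ℝ) ^ q) * Θ ^ (q * δe) * Θ ^ q))
          = (q : ℝ) ^ J * (q : ℝ) * ((q.factorial : ℕ) : ℝ) * (E : ℝ) ^ q * (Θ ^ (q * δe) * Θ ^ q) := by
            ring
        _ ≤ Real.exp (J * (q : ℝ) ^ 2) * Real.exp ((q : ℝ) ^ 2) * Real.exp ((q : ℝ) ^ 2) *
            Real.exp (cE * (q : ℝ) ^ 2) * Real.exp (Θ * ((δe : ℝ) + 1) * (q : ℝ) ^ 2) := by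
            gcongr
        _ = Real.exp (cU * (q : ℝ) ^ 2) := by
            simp only [← Real.exp_add]; congr 1; rw [hcU]; ring
    calc ‖aeval θ N‖ = ‖Mθ.det‖ := by rw [hdet]
      _ = ‖Φ‖ * ‖∑ a' : Fin q, Mθ.adjugate ⟨0, hq⟩ a' * s ^ (a' : ℕ)‖ := by rw [hfact, norm_mul]
      _ ≤ ((q : ℝ) ^ J * (Kl * dJ)) *
            ((q : ℝ) * ((((q.factorial : ℕ) : ℝ) * (E : ℝ) ^ q) * Θ ^ (q * δe) * Θ ^ q)) :=
          mul_le_mul hΦ hS (by positivity) (by positivity)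
      _ = Kl * ((q : ℝ) ^ J * ((q : ℝ) * ((((q.factorial : ℕ) : ℝ) * (E : ℝ) ^ q) *
            Θ ^ (q * δe) * Θ ^ q))) * dJ := by ring
      _ ≤ (Kl + 1) * Real.exp (cU * (q : ℝ) ^ 2) * Real.exp (-Real.exp ((q : ℝ) ^ (A + 1))) := by
          refine mul_le_mul (mul_le_mul (by linarith) hjunk (by positivity) (by positivity)) hdistle
            hd0 (by positivity)
  -- (5) the clash (`kernel_clash_ineq` of `RootDecomp1BRadicalDescent03`, verbatim)
  exact absurd (hlow.trans hup) (not_le.2 (kernel_clash_ineq hKl hcU0 hα0 hc₃ hc₃0 hA1 hq1r hq0r hq2 hQ₁ hqQ₁))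

end Kernel

end Summit.Schanuel.Schanuel.Theorems.RootDecomp1BTwoStorey

end
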